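import Mathlib.Tactic.Ring
import Mathlib.Tactic.Linarith
import Mathlib.Tactic.LinearCombination
import Mathlib.Data.Real.Basic
import HarnessLib

/-!
# Conjecture N (hodge-weil ladder, GAPS G51b), format (4,2): THE PRODUCT FORMULA for `Q₂`, `Q₄`, `G₀`

Prover 2, generation 13 (note `run/shared/lean/b2b/hodge-weil/b2b-hweil-pv2-g13/PRODUCT-FORMULA-G13.md`). Setting of
`CONJECTURE-N.md` §1 (format (4,2), real charges, CENTRED coordinates): E-roots with positions `A₁..A₄` and charges `u₁..u₄`,
F-roots with positions `B₁, B₂` and charges `v₁, v₂`, centring `ΣA = ΣB` (hA), `Σu = Σv` (hC); purity sums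
`P1 = ΣA²u − ΣB²v`, `P2 = ΣAu² − ΣBv²`, `P4 = Σu³ − Σv³`; `Q₂ = ½S_AS_u + S_Au² − 3S_{A²u²}`, `Q₄ = 3S_{u⁴} − (3/2)S_u²`, `G₀ = Q₂ + Q₄`.
For an F-root `f` write `a_e = A_e − B_f`, `b_e = u_e − v_f` (e ∈ E) and `Π_f(y) := ∏_e (b_e + y·a_e) = K₀ + K₁y + K₂y² + …`.
THEOREM (polynomial identities, centring only): with `g` the OTHER F-root,
`Q₄ = −12·K₀ + 4v_g·P4`, `Q₂ = 2·K₂ − 2v_g·P1 − 2B_g·P2`, hence on the pure locus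
`G₀ = 2·Σ_{{i,j}⊔{k,l}=E} (a_ia_j − b_ib_j)·b_kb_l` — every factor `a_ia_j − b_ib_j` is `≥ 0` under pairwise ampleness
`a_e ≥ |b_e|`, so `G₀ ≥ 0` is immediate whenever all `b_e` have one sign (an F-root weakly below or above all E-charges); together with
`K₀(F₁) = K₀(F₂)` (= `∏_e(u_e − v_f)` is the same for both F-roots), `K₁, K₂` likewise, the WALL IDENTITY `K₀ = −(u_e² − S_u/2)(u_e−v₁)(u_e−v₂)`
(each e) and the gauge form of P2, these are the ingredients of the (4,2) case of Conjecture N (companion file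
`WeilClassTestFormatFourTwo.lean`). Pure algebra (`ring` after eliminating `B₂, v₂` by centring); nothing here is a rung, a door edge or a cited
fact; no statement of Markman's papers is used. New cell result ⇒ Summits/.
-/

set_option linter.dupNamespace false

namespace Summit.HodgeConjecture.HodgeConjecture.WeilClassTestProductFormula

/-- PRODUCT FORMULA for `Q₄` relative to the F-root `B₁/v₁`: `Q₄ = −12·∏_e (u_e − v₁) + 4·v₂·P4` (centred charges). -/
theorem Q4_eq_F1 (u₁ u₂ u₃ u₄ v₁ v₂ : ℝ)
    (hC : u₁ + u₂ + u₃ + u₄ = v₁ + v₂) :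
    3 * ((u₁ ^ 4 + u₂ ^ 4 + u₃ ^ 4 + u₄ ^ 4) - (v₁ ^ 4 + v₂ ^ 4)) - (3 / 2) * ((u₁ ^ 2 + u₂ ^ 2 + u₃ ^ 2 + u₄ ^ 2) - (v₁ ^ 2 + v₂ ^ 2)) ^ 2
      = -12 * ((u₁ - v₁) * (u₂ - v₁) * (u₃ - v₁) * (u₄ - v₁))
        + 4 * v₂ * ((u₁ ^ 3 + u₂ ^ 3 + u₃ ^ 3 + u₄ ^ 3) - (v₁ ^ 3 + v₂ ^ 3)) := by
  have hv : v₂ = u₁ + u₂ + u₃ + u₄ - v₁ := by linarith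
  subst hv
  ring

/-- PRODUCT FORMULA for `Q₂` relative to the F-root `B₁/v₁`: `Q₂ = 2·K₂ − 2·v₂·P1 − 2·B₂·P2`,
`K₂ = Σ_{e<e'} a_ea_e'·b_e''b_e'''` (a = A − B₁, b = u − v₁). -/
theorem Q2_eq_F1 (A₁ A₂ A₃ A₄ B₁ B₂ u₁ u₂ u₃ u₄ v₁ v₂ : ℝ)
    (hA : A₁ + A₂ + A₃ + A₄ = B₁ + B₂) (hC : u₁ + u₂ + u₃ + u₄ = v₁ + v₂) :
    (1 / 2) * ((A₁ ^ 2 + A₂ ^ 2 + A₃ ^ 2 + A₄ ^ 2) - (B₁ ^ 2 + B₂ ^ 2)) * ((u₁ ^ 2 + u₂ ^ 2 + u₃ ^ 2 + u₄ ^ 2) - (v₁ ^ 2 + v₂ ^ 2))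
        + ((A₁ * u₁ + A₂ * u₂ + A₃ * u₃ + A₄ * u₄) - (B₁ * v₁ + B₂ * v₂)) ^ 2
        - 3 * ((A₁ ^ 2 * u₁ ^ 2 + A₂ ^ 2 * u₂ ^ 2 + A₃ ^ 2 * u₃ ^ 2 + A₄ ^ 2 * u₄ ^ 2) - (B₁ ^ 2 * v₁ ^ 2 + B₂ ^ 2 * v₂ ^ 2))
      = 2 * ((A₁ - B₁) * (A₂ - B₁) * (u₃ - v₁) * (u₄ - v₁)
          + (A₁ - B₁) * (A₃ - B₁) * (u₂ - v₁) * (u₄ - v₁)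
          + (A₁ - B₁) * (A₄ - B₁) * (u₂ - v₁) * (u₃ - v₁)
          + (A₂ - B₁) * (A₃ - B₁) * (u₁ - v₁) * (u₄ - v₁)
          + (A₂ - B₁) * (A₄ - B₁) * (u₁ - v₁) * (u₃ - v₁)
          + (A₃ - B₁) * (A₄ - B₁) * (u₁ - v₁) * (u₂ - v₁))
        - 2 * v₂ * ((A₁ ^ 2 * u₁ + A₂ ^ 2 * u₂ + A₃ ^ 2 * u₃ + A₄ ^ 2 * u₄) - (B₁ ^ 2 * v₁ + B₂ ^ 2 * v₂))
        - 2 * B₂ * ((A₁ * u₁ ^ 2 + A₂ * u₂ ^ 2 + A₃ * u₃ ^ 2 + A₄ * u₄ ^ 2) - (B₁ * v₁ ^ 2 + B₂ * v₂ ^ 2)) := by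
  have hB : B₂ = A₁ + A₂ + A₃ + A₄ - B₁ := by linarith
  have hv : v₂ = u₁ + u₂ + u₃ + u₄ - v₁ := by linarith
  subst hB; subst hv
  ring

/-- PRODUCT FORMULA for `G₀ = Q₂ + Q₄` relative to the F-root `B₁/v₁`:
`G₀ = 2·Σ_{splits} (a_ia_j − b_ib_j)·b_kb_l − 2v₂·P1 − 2B₂·P2 + 4v₂·P4`; on the pure locus the correction terms vanish. -/
theorem G0_eq_F1 (A₁ A₂ A₃ A₄ B₁ B₂ u₁ u₂ u₃ u₄ v₁ v₂ : ℝ)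
    (hA : A₁ + A₂ + A₃ + A₄ = B₁ + B₂) (hC : u₁ + u₂ + u₃ + u₄ = v₁ + v₂) :
    (1 / 2) * ((A₁ ^ 2 + A₂ ^ 2 + A₃ ^ 2 + A₄ ^ 2) - (B₁ ^ 2 + B₂ ^ 2)) * ((u₁ ^ 2 + u₂ ^ 2 + u₃ ^ 2 + u₄ ^ 2) - (v₁ ^ 2 + v₂ ^ 2))
        + ((A₁ * u₁ + A₂ * u₂ + A₃ * u₃ + A₄ * u₄) - (B₁ * v₁ + B₂ * v₂)) ^ 2
        - 3 * ((A₁ ^ 2 * u₁ ^ 2 + A₂ ^ 2 * u₂ ^ 2 + A₃ ^ 2 * u₃ ^ 2 + A₄ ^ 2 * u₄ ^ 2) - (B₁ ^ 2 * v₁ ^ 2 + B₂ ^ 2 * v₂ ^ 2))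
      + (3 * ((u₁ ^ 4 + u₂ ^ 4 + u₃ ^ 4 + u₄ ^ 4) - (v₁ ^ 4 + v₂ ^ 4)) - (3 / 2) * ((u₁ ^ 2 + u₂ ^ 2 + u₃ ^ 2 + u₄ ^ 2) - (v₁ ^ 2 + v₂ ^ 2)) ^ 2)
      = 2 * (((A₁ - B₁) * (A₂ - B₁) - (u₁ - v₁) * (u₂ - v₁)) * ((u₃ - v₁) * (u₄ - v₁))
          + ((A₁ - B₁) * (A₃ - B₁) - (u₁ - v₁) * (u₃ - v₁)) * ((u₂ - v₁) * (u₄ - v₁))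
          + ((A₁ - B₁) * (A₄ - B₁) - (u₁ - v₁) * (u₄ - v₁)) * ((u₂ - v₁) * (u₃ - v₁))
          + ((A₂ - B₁) * (A₃ - B₁) - (u₂ - v₁) * (u₃ - v₁)) * ((u₁ - v₁) * (u₄ - v₁))
          + ((A₂ - B₁) * (A₄ - B₁) - (u₂ - v₁) * (u₄ - v₁)) * ((u₁ - v₁) * (u₃ - v₁))
          + ((A₃ - B₁) * (A₄ - B₁) - (u₃ - v₁) * (u₄ - v₁)) * ((u₁ - v₁) * (u₂ - v₁)))
        - 2 * v₂ * ((A₁ ^ 2 * u₁ + A₂ ^ 2 * u₂ + A₃ ^ 2 * u₃ + A₄ ^ 2 * u₄) - (B₁ ^ 2 * v₁ + B₂ ^ 2 * v₂))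
        - 2 * B₂ * ((A₁ * u₁ ^ 2 + A₂ * u₂ ^ 2 + A₃ * u₃ ^ 2 + A₄ * u₄ ^ 2) - (B₁ * v₁ ^ 2 + B₂ * v₂ ^ 2))
        + 4 * v₂ * ((u₁ ^ 3 + u₂ ^ 3 + u₃ ^ 3 + u₄ ^ 3) - (v₁ ^ 3 + v₂ ^ 3)) := by
  have hB : B₂ = A₁ + A₂ + A₃ + A₄ - B₁ := by linarith
  have hv : v₂ = u₁ + u₂ + u₃ + u₄ - v₁ := by linarith
  subst hB; subst hv
  ring

/-- The first-order coefficient `K₁ = Σ_e a_e ∏_{e'≠e} b_e'` relative to `B₁/v₁` and the charge-(±2) moment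
`c₁ := 12·Σε Z³Y − 6·S_u·S_{YZ}`: `c₁ = −12·K₁ + 12v₂·P2 + 4B₂·P4`. -/
theorem c1_eq_F1 (A₁ A₂ A₃ A₄ B₁ B₂ u₁ u₂ u₃ u₄ v₁ v₂ : ℝ)
    (hA : A₁ + A₂ + A₃ + A₄ = B₁ + B₂) (hC : u₁ + u₂ + u₃ + u₄ = v₁ + v₂) :
    12 * ((u₁ ^ 3 * A₁ + u₂ ^ 3 * A₂ + u₃ ^ 3 * A₃ + u₄ ^ 3 * A₄) - (v₁ ^ 3 * B₁ + v₂ ^ 3 * B₂))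
      - 6 * ((u₁ ^ 2 + u₂ ^ 2 + u₃ ^ 2 + u₄ ^ 2) - (v₁ ^ 2 + v₂ ^ 2)) * ((A₁ * u₁ + A₂ * u₂ + A₃ * u₃ + A₄ * u₄) - (B₁ * v₁ + B₂ * v₂))
      = -12 * ((A₁ - B₁) * (u₂ - v₁) * (u₃ - v₁) * (u₄ - v₁)
      + (A₂ - B₁) * (u₁ - v₁) * (u₃ - v₁) * (u₄ - v₁)
      + (A₃ - B₁) * (u₁ - v₁) * (u₂ - v₁) * (u₄ - v₁)
      + (A₄ - B₁) * (u₁ - v₁) * (u₂ - v₁) * (u₃ - v₁))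
        + 12 * v₂ * ((A₁ * u₁ ^ 2 + A₂ * u₂ ^ 2 + A₃ * u₃ ^ 2 + A₄ * u₄ ^ 2) - (B₁ * v₁ ^ 2 + B₂ * v₂ ^ 2))
        + 4 * B₂ * ((u₁ ^ 3 + u₂ ^ 3 + u₃ ^ 3 + u₄ ^ 3) - (v₁ ^ 3 + v₂ ^ 3)) := by
  have hB : B₂ = A₁ + A₂ + A₃ + A₄ - B₁ := by linarith
  have hv : v₂ = u₁ + u₂ + u₃ + u₄ - v₁ := by linarith
  subst hB; subst hv
  ring

/-- PRODUCT FORMULA for `Q₄` relative to the F-root `B₂/v₂`: `Q₄ = −12·∏_e (u_e − v₂) + 4·v₁·P4` (centred charges). -/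
theorem Q4_eq_F2 (u₁ u₂ u₃ u₄ v₁ v₂ : ℝ)
    (hC : u₁ + u₂ + u₃ + u₄ = v₁ + v₂) :
    3 * ((u₁ ^ 4 + u₂ ^ 4 + u₃ ^ 4 + u₄ ^ 4) - (v₁ ^ 4 + v₂ ^ 4)) - (3 / 2) * ((u₁ ^ 2 + u₂ ^ 2 + u₃ ^ 2 + u₄ ^ 2) - (v₁ ^ 2 + v₂ ^ 2)) ^ 2
      = -12 * ((u₁ - v₂) * (u₂ - v₂) * (u₃ - v₂) * (u₄ - v₂))
        + 4 * v₁ * ((u₁ ^ 3 + u₂ ^ 3 + u₃ ^ 3 + u₄ ^ 3) - (v₁ ^ 3 + v₂ ^ 3)) := by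
  have hv : v₂ = u₁ + u₂ + u₃ + u₄ - v₁ := by linarith
  subst hv
  ring

/-- PRODUCT FORMULA for `Q₂` relative to the F-root `B₂/v₂`: `Q₂ = 2·K₂ − 2·v₁·P1 − 2·B₁·P2`,
`K₂ = Σ_{e<e'} a_ea_e'·b_e''b_e'''` (a = A − B₂, b = u − v₂). -/
theorem Q2_eq_F2 (A₁ A₂ A₃ A₄ B₁ B₂ u₁ u₂ u₃ u₄ v₁ v₂ : ℝ)
    (hA : A₁ + A₂ + A₃ + A₄ = B₁ + B₂) (hC : u₁ + u₂ + u₃ + u₄ = v₁ + v₂) :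
    (1 / 2) * ((A₁ ^ 2 + A₂ ^ 2 + A₃ ^ 2 + A₄ ^ 2) - (B₁ ^ 2 + B₂ ^ 2)) * ((u₁ ^ 2 + u₂ ^ 2 + u₃ ^ 2 + u₄ ^ 2) - (v₁ ^ 2 + v₂ ^ 2))
        + ((A₁ * u₁ + A₂ * u₂ + A₃ * u₃ + A₄ * u₄) - (B₁ * v₁ + B₂ * v₂)) ^ 2
        - 3 * ((A₁ ^ 2 * u₁ ^ 2 + A₂ ^ 2 * u₂ ^ 2 + A₃ ^ 2 * u₃ ^ 2 + A₄ ^ 2 * u₄ ^ 2) - (B₁ ^ 2 * v₁ ^ 2 + B₂ ^ 2 * v₂ ^ 2))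
      = 2 * ((A₁ - B₂) * (A₂ - B₂) * (u₃ - v₂) * (u₄ - v₂)
          + (A₁ - B₂) * (A₃ - B₂) * (u₂ - v₂) * (u₄ - v₂)
          + (A₁ - B₂) * (A₄ - B₂) * (u₂ - v₂) * (u₃ - v₂)
          + (A₂ - B₂) * (A₃ - B₂) * (u₁ - v₂) * (u₄ - v₂)
          + (A₂ - B₂) * (A₄ - B₂) * (u₁ - v₂) * (u₃ - v₂)
          + (A₃ - B₂) * (A₄ - B₂) * (u₁ - v₂) * (u₂ - v₂))
        - 2 * v₁ * ((A₁ ^ 2 * u₁ + A₂ ^ 2 * u₂ + A₃ ^ 2 * u₃ + A₄ ^ 2 * u₄) - (B₁ ^ 2 * v₁ + B₂ ^ 2 * v₂))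
        - 2 * B₁ * ((A₁ * u₁ ^ 2 + A₂ * u₂ ^ 2 + A₃ * u₃ ^ 2 + A₄ * u₄ ^ 2) - (B₁ * v₁ ^ 2 + B₂ * v₂ ^ 2)) := by
  have hB : B₂ = A₁ + A₂ + A₃ + A₄ - B₁ := by linarith
  have hv : v₂ = u₁ + u₂ + u₃ + u₄ - v₁ := by linarith
  subst hB; subst hv
  ring

/-- PRODUCT FORMULA for `G₀ = Q₂ + Q₄` relative to the F-root `B₂/v₂`:
`G₀ = 2·Σ_{splits} (a_ia_j − b_ib_j)·b_kb_l − 2v₁·P1 − 2B₁·P2 + 4v₁·P4`; on the pure locus the correction terms vanish. -/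
theorem G0_eq_F2 (A₁ A₂ A₃ A₄ B₁ B₂ u₁ u₂ u₃ u₄ v₁ v₂ : ℝ)
    (hA : A₁ + A₂ + A₃ + A₄ = B₁ + B₂) (hC : u₁ + u₂ + u₃ + u₄ = v₁ + v₂) :
    (1 / 2) * ((A₁ ^ 2 + A₂ ^ 2 + A₃ ^ 2 + A₄ ^ 2) - (B₁ ^ 2 + B₂ ^ 2)) * ((u₁ ^ 2 + u₂ ^ 2 + u₃ ^ 2 + u₄ ^ 2) - (v₁ ^ 2 + v₂ ^ 2))
        + ((A₁ * u₁ + A₂ * u₂ + A₃ * u₃ + A₄ * u₄) - (B₁ * v₁ + B₂ * v₂)) ^ 2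
        - 3 * ((A₁ ^ 2 * u₁ ^ 2 + A₂ ^ 2 * u₂ ^ 2 + A₃ ^ 2 * u₃ ^ 2 + A₄ ^ 2 * u₄ ^ 2) - (B₁ ^ 2 * v₁ ^ 2 + B₂ ^ 2 * v₂ ^ 2))
      + (3 * ((u₁ ^ 4 + u₂ ^ 4 + u₃ ^ 4 + u₄ ^ 4) - (v₁ ^ 4 + v₂ ^ 4)) - (3 / 2) * ((u₁ ^ 2 + u₂ ^ 2 + u₃ ^ 2 + u₄ ^ 2) - (v₁ ^ 2 + v₂ ^ 2)) ^ 2)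
      = 2 * (((A₁ - B₂) * (A₂ - B₂) - (u₁ - v₂) * (u₂ - v₂)) * ((u₃ - v₂) * (u₄ - v₂))
          + ((A₁ - B₂) * (A₃ - B₂) - (u₁ - v₂) * (u₃ - v₂)) * ((u₂ - v₂) * (u₄ - v₂))
          + ((A₁ - B₂) * (A₄ - B₂) - (u₁ - v₂) * (u₄ - v₂)) * ((u₂ - v₂) * (u₃ - v₂))
          + ((A₂ - B₂) * (A₃ - B₂) - (u₂ - v₂) * (u₃ - v₂)) * ((u₁ - v₂) * (u₄ - v₂))
          + ((A₂ - B₂) * (A₄ - B₂) - (u₂ - v₂) * (u₄ - v₂)) * ((u₁ - v₂) * (u₃ - v₂))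
          + ((A₃ - B₂) * (A₄ - B₂) - (u₃ - v₂) * (u₄ - v₂)) * ((u₁ - v₂) * (u₂ - v₂)))
        - 2 * v₁ * ((A₁ ^ 2 * u₁ + A₂ ^ 2 * u₂ + A₃ ^ 2 * u₃ + A₄ ^ 2 * u₄) - (B₁ ^ 2 * v₁ + B₂ ^ 2 * v₂))
        - 2 * B₁ * ((A₁ * u₁ ^ 2 + A₂ * u₂ ^ 2 + A₃ * u₃ ^ 2 + A₄ * u₄ ^ 2) - (B₁ * v₁ ^ 2 + B₂ * v₂ ^ 2))
        + 4 * v₁ * ((u₁ ^ 3 + u₂ ^ 3 + u₃ ^ 3 + u₄ ^ 3) - (v₁ ^ 3 + v₂ ^ 3)) := by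
  have hB : B₂ = A₁ + A₂ + A₃ + A₄ - B₁ := by linarith
  have hv : v₂ = u₁ + u₂ + u₃ + u₄ - v₁ := by linarith
  subst hB; subst hv
  ring

/-- The first-order coefficient `K₁ = Σ_e a_e ∏_{e'≠e} b_e'` relative to `B₂/v₂` and the charge-(±2) moment
`c₁ := 12·Σε Z³Y − 6·S_u·S_{YZ}`: `c₁ = −12·K₁ + 12v₁·P2 + 4B₁·P4`. -/
theorem c1_eq_F2 (A₁ A₂ A₃ A₄ B₁ B₂ u₁ u₂ u₃ u₄ v₁ v₂ : ℝ)
    (hA : A₁ + A₂ + A₃ + A₄ = B₁ + B₂) (hC : u₁ + u₂ + u₃ + u₄ = v₁ + v₂) :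
    12 * ((u₁ ^ 3 * A₁ + u₂ ^ 3 * A₂ + u₃ ^ 3 * A₃ + u₄ ^ 3 * A₄) - (v₁ ^ 3 * B₁ + v₂ ^ 3 * B₂))
      - 6 * ((u₁ ^ 2 + u₂ ^ 2 + u₃ ^ 2 + u₄ ^ 2) - (v₁ ^ 2 + v₂ ^ 2)) * ((A₁ * u₁ + A₂ * u₂ + A₃ * u₃ + A₄ * u₄) - (B₁ * v₁ + B₂ * v₂))
      = -12 * ((A₁ - B₂) * (u₂ - v₂) * (u₃ - v₂) * (u₄ - v₂)
      + (A₂ - B₂) * (u₁ - v₂) * (u₃ - v₂) * (u₄ - v₂)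
      + (A₃ - B₂) * (u₁ - v₂) * (u₂ - v₂) * (u₄ - v₂)
      + (A₄ - B₂) * (u₁ - v₂) * (u₂ - v₂) * (u₃ - v₂))
        + 12 * v₁ * ((A₁ * u₁ ^ 2 + A₂ * u₂ ^ 2 + A₃ * u₃ ^ 2 + A₄ * u₄ ^ 2) - (B₁ * v₁ ^ 2 + B₂ * v₂ ^ 2))
        + 4 * B₁ * ((u₁ ^ 3 + u₂ ^ 3 + u₃ ^ 3 + u₄ ^ 3) - (v₁ ^ 3 + v₂ ^ 3)) := by
  have hB : B₂ = A₁ + A₂ + A₃ + A₄ - B₁ := by linarith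
  have hv : v₂ = u₁ + u₂ + u₃ + u₄ - v₁ := by linarith
  subst hB; subst hv
  ring

/-- `K₀(F₁) − K₀(F₂) = ((v₂ − v₁)/3)·P4`: on the pure locus `∏_e(u_e − v₁) = ∏_e(u_e − v₂)`. -/
theorem K0_F1_sub_K0_F2 (u₁ u₂ u₃ u₄ v₁ v₂ : ℝ)
    (hC : u₁ + u₂ + u₃ + u₄ = v₁ + v₂) :
    ((u₁ - v₁) * (u₂ - v₁) * (u₃ - v₁) * (u₄ - v₁)) - ((u₁ - v₂) * (u₂ - v₂) * (u₃ - v₂) * (u₄ - v₂)) = (v₂ - v₁) / 3 * ((u₁ ^ 3 + u₂ ^ 3 + u₃ ^ 3 + u₄ ^ 3) - (v₁ ^ 3 + v₂ ^ 3)) := by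
  have hv : v₂ = u₁ + u₂ + u₃ + u₄ - v₁ := by linarith
  subst hv
  ring

/-- `K₁(F₁) − K₁(F₂) = (v₂ − v₁)·P2 + ((B₂ − B₁)/3)·P4`. -/
theorem K1_F1_sub_K1_F2 (A₁ A₂ A₃ A₄ B₁ B₂ u₁ u₂ u₃ u₄ v₁ v₂ : ℝ)
    (hA : A₁ + A₂ + A₃ + A₄ = B₁ + B₂) (hC : u₁ + u₂ + u₃ + u₄ = v₁ + v₂) :
    ((A₁ - B₁) * (u₂ - v₁) * (u₃ - v₁) * (u₄ - v₁)
      + (A₂ - B₁) * (u₁ - v₁) * (u₃ - v₁) * (u₄ - v₁)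
      + (A₃ - B₁) * (u₁ - v₁) * (u₂ - v₁) * (u₄ - v₁)
      + (A₄ - B₁) * (u₁ - v₁) * (u₂ - v₁) * (u₃ - v₁))
      - ((A₁ - B₂) * (u₂ - v₂) * (u₃ - v₂) * (u₄ - v₂)
      + (A₂ - B₂) * (u₁ - v₂) * (u₃ - v₂) * (u₄ - v₂)
      + (A₃ - B₂) * (u₁ - v₂) * (u₂ - v₂) * (u₄ - v₂)
      + (A₄ - B₂) * (u₁ - v₂) * (u₂ - v₂) * (u₃ - v₂))
      = (v₂ - v₁) * ((A₁ * u₁ ^ 2 + A₂ * u₂ ^ 2 + A₃ * u₃ ^ 2 + A₄ * u₄ ^ 2) - (B₁ * v₁ ^ 2 + B₂ * v₂ ^ 2)) + (B₂ - B₁) / 3 * ((u₁ ^ 3 + u₂ ^ 3 + u₃ ^ 3 + u₄ ^ 3) - (v₁ ^ 3 + v₂ ^ 3)) := by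
  have hB : B₂ = A₁ + A₂ + A₃ + A₄ - B₁ := by linarith
  have hv : v₂ = u₁ + u₂ + u₃ + u₄ - v₁ := by linarith
  subst hB; subst hv
  ring

/-- `K₂(F₁) − K₂(F₂) = (v₂ − v₁)·P1 + (B₂ − B₁)·P2`. -/
theorem K2_F1_sub_K2_F2 (A₁ A₂ A₃ A₄ B₁ B₂ u₁ u₂ u₃ u₄ v₁ v₂ : ℝ)
    (hA : A₁ + A₂ + A₃ + A₄ = B₁ + B₂) (hC : u₁ + u₂ + u₃ + u₄ = v₁ + v₂) :
    ((A₁ - B₁) * (A₂ - B₁) * (u₃ - v₁) * (u₄ - v₁)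
          + (A₁ - B₁) * (A₃ - B₁) * (u₂ - v₁) * (u₄ - v₁)
          + (A₁ - B₁) * (A₄ - B₁) * (u₂ - v₁) * (u₃ - v₁)
          + (A₂ - B₁) * (A₃ - B₁) * (u₁ - v₁) * (u₄ - v₁)
          + (A₂ - B₁) * (A₄ - B₁) * (u₁ - v₁) * (u₃ - v₁)
          + (A₃ - B₁) * (A₄ - B₁) * (u₁ - v₁) * (u₂ - v₁))
      - ((A₁ - B₂) * (A₂ - B₂) * (u₃ - v₂) * (u₄ - v₂)
          + (A₁ - B₂) * (A₃ - B₂) * (u₂ - v₂) * (u₄ - v₂)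
          + (A₁ - B₂) * (A₄ - B₂) * (u₂ - v₂) * (u₃ - v₂)
          + (A₂ - B₂) * (A₃ - B₂) * (u₁ - v₂) * (u₄ - v₂)
          + (A₂ - B₂) * (A₄ - B₂) * (u₁ - v₂) * (u₃ - v₂)
          + (A₃ - B₂) * (A₄ - B₂) * (u₁ - v₂) * (u₂ - v₂))
      = (v₂ - v₁) * ((A₁ ^ 2 * u₁ + A₂ ^ 2 * u₂ + A₃ ^ 2 * u₃ + A₄ ^ 2 * u₄) - (B₁ ^ 2 * v₁ + B₂ ^ 2 * v₂)) + (B₂ - B₁) * ((A₁ * u₁ ^ 2 + A₂ * u₂ ^ 2 + A₃ * u₃ ^ 2 + A₄ * u₄ ^ 2) - (B₁ * v₁ ^ 2 + B₂ * v₂ ^ 2)) := by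
  have hB : B₂ = A₁ + A₂ + A₃ + A₄ - B₁ := by linarith
  have hv : v₂ = u₁ + u₂ + u₃ + u₄ - v₁ := by linarith
  subst hB; subst hv
  ring

/-- WALL IDENTITY for `E₁`: with the wall `w = u₁² − S_u/2` (centred charges),
`∏_e(u_e − v₁) + w·(u₁ − v₁)(u₁ − v₂) = ((u₁ − v₁)/3)·P4` — on the pure locus `K₀ = −w_e·(u_e − v₁)(u_e − v₂)`. -/
theorem K0_add_wall_mul₁ (u₁ u₂ u₃ u₄ v₁ v₂ : ℝ)
    (hC : u₁ + u₂ + u₃ + u₄ = v₁ + v₂) :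
    ((u₁ - v₁) * (u₂ - v₁) * (u₃ - v₁) * (u₄ - v₁)) + (u₁ ^ 2 - ((u₁ ^ 2 + u₂ ^ 2 + u₃ ^ 2 + u₄ ^ 2) - (v₁ ^ 2 + v₂ ^ 2)) / 2) * ((u₁ - v₁) * (u₁ - v₂))
      = (u₁ - v₁) / 3 * ((u₁ ^ 3 + u₂ ^ 3 + u₃ ^ 3 + u₄ ^ 3) - (v₁ ^ 3 + v₂ ^ 3)) := by
  have hv : v₂ = u₁ + u₂ + u₃ + u₄ - v₁ := by linarith
  subst hv
  ring

/-- WALL IDENTITY for `E₂`: with the wall `w = u₂² − S_u/2` (centred charges),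
`∏_e(u_e − v₁) + w·(u₂ − v₁)(u₂ − v₂) = ((u₂ − v₁)/3)·P4` — on the pure locus `K₀ = −w_e·(u_e − v₁)(u_e − v₂)`. -/
theorem K0_add_wall_mul₂ (u₁ u₂ u₃ u₄ v₁ v₂ : ℝ)
    (hC : u₁ + u₂ + u₃ + u₄ = v₁ + v₂) :
    ((u₁ - v₁) * (u₂ - v₁) * (u₃ - v₁) * (u₄ - v₁)) + (u₂ ^ 2 - ((u₁ ^ 2 + u₂ ^ 2 + u₃ ^ 2 + u₄ ^ 2) - (v₁ ^ 2 + v₂ ^ 2)) / 2) * ((u₂ - v₁) * (u₂ - v₂))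
      = (u₂ - v₁) / 3 * ((u₁ ^ 3 + u₂ ^ 3 + u₃ ^ 3 + u₄ ^ 3) - (v₁ ^ 3 + v₂ ^ 3)) := by
  have hv : v₂ = u₁ + u₂ + u₃ + u₄ - v₁ := by linarith
  subst hv
  ring

/-- WALL IDENTITY for `E₃`: with the wall `w = u₃² − S_u/2` (centred charges),
`∏_e(u_e − v₁) + w·(u₃ − v₁)(u₃ − v₂) = ((u₃ − v₁)/3)·P4` — on the pure locus `K₀ = −w_e·(u_e − v₁)(u_e − v₂)`. -/
theorem K0_add_wall_mul₃ (u₁ u₂ u₃ u₄ v₁ v₂ : ℝ)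
    (hC : u₁ + u₂ + u₃ + u₄ = v₁ + v₂) :
    ((u₁ - v₁) * (u₂ - v₁) * (u₃ - v₁) * (u₄ - v₁)) + (u₃ ^ 2 - ((u₁ ^ 2 + u₂ ^ 2 + u₃ ^ 2 + u₄ ^ 2) - (v₁ ^ 2 + v₂ ^ 2)) / 2) * ((u₃ - v₁) * (u₃ - v₂))
      = (u₃ - v₁) / 3 * ((u₁ ^ 3 + u₂ ^ 3 + u₃ ^ 3 + u₄ ^ 3) - (v₁ ^ 3 + v₂ ^ 3)) := by
  have hv : v₂ = u₁ + u₂ + u₃ + u₄ - v₁ := by linarith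
  subst hv
  ring

/-- WALL IDENTITY for `E₄`: with the wall `w = u₄² − S_u/2` (centred charges),
`∏_e(u_e − v₁) + w·(u₄ − v₁)(u₄ − v₂) = ((u₄ − v₁)/3)·P4` — on the pure locus `K₀ = −w_e·(u_e − v₁)(u_e − v₂)`. -/
theorem K0_add_wall_mul₄ (u₁ u₂ u₃ u₄ v₁ v₂ : ℝ)
    (hC : u₁ + u₂ + u₃ + u₄ = v₁ + v₂) :
    ((u₁ - v₁) * (u₂ - v₁) * (u₃ - v₁) * (u₄ - v₁)) + (u₄ ^ 2 - ((u₁ ^ 2 + u₂ ^ 2 + u₃ ^ 2 + u₄ ^ 2) - (v₁ ^ 2 + v₂ ^ 2)) / 2) * ((u₄ - v₁) * (u₄ - v₂))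
      = (u₄ - v₁) / 3 * ((u₁ ^ 3 + u₂ ^ 3 + u₃ ^ 3 + u₄ ^ 3) - (v₁ ^ 3 + v₂ ^ 3)) := by
  have hv : v₂ = u₁ + u₂ + u₃ + u₄ - v₁ := by linarith
  subst hv
  ring

/-- The walls of a centred (4,2) charge vector sum to zero with signs: `Σ_E (u_e² − S_u/2) − Σ_F (v_f² − S_u/2) = 0`. -/
theorem walls_signed_sum (u₁ u₂ u₃ u₄ v₁ v₂ : ℝ) :
    ((u₁ ^ 2 - ((u₁ ^ 2 + u₂ ^ 2 + u₃ ^ 2 + u₄ ^ 2) - (v₁ ^ 2 + v₂ ^ 2)) / 2)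
      + (u₂ ^ 2 - ((u₁ ^ 2 + u₂ ^ 2 + u₃ ^ 2 + u₄ ^ 2) - (v₁ ^ 2 + v₂ ^ 2)) / 2)
      + (u₃ ^ 2 - ((u₁ ^ 2 + u₂ ^ 2 + u₃ ^ 2 + u₄ ^ 2) - (v₁ ^ 2 + v₂ ^ 2)) / 2)
      + (u₄ ^ 2 - ((u₁ ^ 2 + u₂ ^ 2 + u₃ ^ 2 + u₄ ^ 2) - (v₁ ^ 2 + v₂ ^ 2)) / 2))
      - ((v₁ ^ 2 - ((u₁ ^ 2 + u₂ ^ 2 + u₃ ^ 2 + u₄ ^ 2) - (v₁ ^ 2 + v₂ ^ 2)) / 2) + (v₂ ^ 2 - ((u₁ ^ 2 + u₂ ^ 2 + u₃ ^ 2 + u₄ ^ 2) - (v₁ ^ 2 + v₂ ^ 2)) / 2)) = 0 := by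
  ring

/-- GAUGE FORM of P2: for ANY level `yV`, `P2 = Σ_E (A_e − yV)·(u_e² − S_u/2) + Σ_F (yV − B_f)·(v_f² − S_u/2)` (the heights
`A_e − yV`, `yV − B_f` are `≥ 0` for a level between the F- and the E-positions). -/
theorem P2_gauge (A₁ A₂ A₃ A₄ B₁ B₂ u₁ u₂ u₃ u₄ v₁ v₂ : ℝ) (yV : ℝ)
    (hA : A₁ + A₂ + A₃ + A₄ = B₁ + B₂) :
    (A₁ * u₁ ^ 2 + A₂ * u₂ ^ 2 + A₃ * u₃ ^ 2 + A₄ * u₄ ^ 2) - (B₁ * v₁ ^ 2 + B₂ * v₂ ^ 2)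
      = ((A₁ - yV) * (u₁ ^ 2 - ((u₁ ^ 2 + u₂ ^ 2 + u₃ ^ 2 + u₄ ^ 2) - (v₁ ^ 2 + v₂ ^ 2)) / 2)
      + (A₂ - yV) * (u₂ ^ 2 - ((u₁ ^ 2 + u₂ ^ 2 + u₃ ^ 2 + u₄ ^ 2) - (v₁ ^ 2 + v₂ ^ 2)) / 2)
         
      + (A₃ - yV) * (u₃ ^ 2 - ((u₁ ^ 2 + u₂ ^ 2 + u₃ ^ 2 + u₄ ^ 2) - (v₁ ^ 2 + v₂ ^ 2)) / 2)
      + (A₄ - yV) * (u₄ ^ 2 - ((u₁ ^ 2 + u₂ ^ 2 + u₃ ^ 2 + u₄ ^ 2) - (v₁ ^ 2 + v₂ ^ 2)) / 2))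
        + ((yV - B₁) * (v₁ ^ 2 - ((u₁ ^ 2 + u₂ ^ 2 + u₃ ^ 2 + u₄ ^ 2) - (v₁ ^ 2 + v₂ ^ 2)) / 2)
          
          + (yV - B₂) * (v₂ ^ 2 - ((u₁ ^ 2 + u₂ ^ 2 + u₃ ^ 2 + u₄ ^ 2) - (v₁ ^ 2 + v₂ ^ 2)) / 2)) := by
  have hB : B₂ = A₁ + A₂ + A₃ + A₄ - B₁ := by linarith
  subst hB
  ring

end Summit.HodgeConjecture.HodgeConjecture.WeilClassTestProductFormula
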